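import Mathlib.Topology.Homotopy.Equiv
import Mathlib.Topology.UnitInterval
import Mathlib.Topology.Maps.Proper.Basic
import HarnessLib

/-!
# Pushing a space off a collared boundary: the interior and the cores are deformation retracts

Topic `Literature/AlgebraicTopology/Homotopy`. Elementary homotopy theory of a *collar*: a closed
embedding `κ : A × [0, 1] → W` such that the half-open collar `κ (A × [0, 1))` is open in `W`
(`Literature.AlgebraicTopology.Homotopy.BoundaryCollar`; for a compact smooth manifold with boundary
`W` and `A = ∂W` such collars exist, `Literature.Topology.FourManifolds.BoundaryData.nonempty_collar_of_compactSpace`).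
Think of `κ (A × {0})` as the boundary of `W`; its complement `κ.interior` is "the interior", and
for a level `t ∈ [0, 1]` the *core* `κ.core t = W ∖ κ (A × [0, t))` is the space with an open collar
of height `t` removed.

* `BoundaryCollar.push t : W → W` — **the push to level `t`**: `κ (a, s) ↦ κ (a, max s t)` on the
  collar, the identity off it; jointly continuous in `(t, w)` (`continuous_push`, pasting along the
  closed cover `range κ ∪ (W ∖ κ (A × [0, 1)))`), `push 0 = id`, `push t = id` on the core,
  `push t (W) ⊆ core t`.
* `BoundaryCollar.inclusionHomotopyEquiv` — if `P ⊆ Q ⊆ W` are stable under the pushes to levels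
  `≤ t` and `push t (Q) ⊆ P`, the inclusion `P ↪ Q` is a homotopy equivalence (inverse `push t`,
  homotopies `s ↦ push (min t (1 - s))`).
* Consequences: the inclusions `κ.interior ↪ W` (`interiorHomotopyEquiv`) and, for a point `c`
  above level `t` (`c ∉ κ (A × [0, t])`), `κ.interior ∖ {c} ↪ W ∖ {c}`
  (`interiorComplHomotopyEquiv`) are homotopy equivalences; the cores are compact when `W` is
  (`isCompact_core`) and contained in the interior for `t > 0` (`core_subset_interior`).
* `BoundaryCollar.stripHomotopyEquiv` — the slice `a ↦ κ (a, u)` at a fixed level `0 < u < t` is a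
  homotopy equivalence `A ≃ₕ κ (A × (0, t))` onto the open strip
  between the boundary and level `t` (inverse: the `A`-coordinate), and `a ↦ κ (a, u)` is homotopic
  in `W ∖ {c}` to the boundary inclusion `a ↦ κ (a, 0)` (`sliceHomotopic`).

These are the homotopy-theoretic book-keeping facts by which the homology of a compact manifold with
boundary is read off its interior (where local homology and orientations live) in the degree
argument of Kervaire–Milnor's Lemma 2.3 (*Groups of homotopy spheres I* (1963), p. 506), see
`Literature/Topology/FourManifolds/RotationBodyHCobordism.lean`. Mathlib has homotopy equivalences but
no collars or deformation retractions; compare the tree's `CollaredDeformationRetract.lean` (two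
pieces meeting along a collared subspace), whose pasting technique is reused here.

## References

* A. Hatcher, *Algebraic Topology*, CUP (2002), Ch. 0 (deformation retractions; Example 0.15,
  collars), Prop. 3.42 (a compact manifold with boundary deformation retracts onto the complement
  of an open collar). [HatcherAT2002]
-/

noncomputable section

open Set Function Topology
open scoped unitInterval Topology ContinuousMap

universe u v

namespace Literature.AlgebraicTopology.Homotopy

/-- A **(topological) boundary collar** on a space `W`, parametrised by a space `A`: a closed
embedding `κ : A × [0, 1] → W` whose restriction to `A × [0, 1)` has open image. For a compact smooth
manifold with boundary and `A = ∂W` this is the topological content of a smooth collar (Hirsch,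
*Differential Topology* (1976), §4.6; Hatcher 2002, Example 0.15 / Prop. 3.42). [folklore] -/
structure BoundaryCollar (W : Type u) [TopologicalSpace W] (A : Type v) [TopologicalSpace A] where
  /-- The collar map `A × [0, 1] → W`. -/
  collar : A × I → W
  /-- The collar is a closed embedding. -/
  isClosedEmbedding_collar : IsClosedEmbedding collar
  /-- The half-open collar `κ (A × [0, 1))` is open in `W`. -/
  isOpen_image : IsOpen (collar '' {q | q.2 < 1})

namespace BoundaryCollar

variable {W : Type u} [TopologicalSpace W] {A : Type v} [TopologicalSpace A]
  (κ : BoundaryCollar W A)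

attribute [local instance] Classical.propDecidable

/-! ### The collar and its inverse -/

/-- The collar is continuous. [folklore] -/
protected theorem continuous : Continuous κ.collar := κ.isClosedEmbedding_collar.continuous

/-- The collar is injective. [folklore] -/
protected theorem injective : Injective κ.collar := κ.isClosedEmbedding_collar.injective

/-- Membership of a collar point in the image of a set of collar coordinates. [folklore] -/
theorem collar_mem_image_iff {q : A × I} {s : Set (A × I)} : κ.collar q ∈ κ.collar '' s ↔ q ∈ s :=
  κ.injective.mem_set_image

/-- **The open sub-collars**: for `t ≤ 1` the image `κ (A × [0, t))`, and more generally the image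
of any open set of coordinates below level `1`, is open in `W` (the restriction of `κ` to
`A × [0, 1)` is an open embedding onto the open half-collar). [folklore] -/
theorem isOpen_image_of_isOpen {s : Set (A × I)} (hs : IsOpen s) (hs1 : s ⊆ {q | q.2 < 1}) :
    IsOpen (κ.collar '' s) := by
  -- the restriction of `κ` to the open set `V = A × [0, 1)` is an open embedding
  set V : Set (A × I) := {q | q.2 < 1} with hV
  have hVo : IsOpen V := isOpen_lt continuous_snd continuous_const
  have hemb : IsOpenEmbedding (V.restrict κ.collar) := by
    refine ⟨κ.isClosedEmbedding_collar.isEmbedding.comp IsEmbedding.subtypeVal, ?_⟩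
    rw [Set.range_restrict]
    exact κ.isOpen_image
  have h : κ.collar '' s = V.restrict κ.collar '' (Subtype.val ⁻¹' s) := by
    ext w
    simp only [mem_image, restrict_apply, mem_preimage, Subtype.exists, exists_and_right]
    constructor
    · rintro ⟨q, hq, rfl⟩
      exact ⟨q, ⟨hs1 hq, hq⟩, rfl⟩
    · rintro ⟨q, ⟨_, hq⟩, rfl⟩
      exact ⟨q, hq, rfl⟩
  rw [h]
  exact hemb.isOpenMap _ (hs.preimage continuous_subtype_val)

/-- The open collar below level `t`: `κ (A × [0, t))`. [folklore] -/
def below (t : I) : Set W := κ.collar '' {q | q.2 < t}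

/-- Membership of a collar point in `below t`: its level is `< t`. [folklore] -/
@[simp] theorem collar_mem_below_iff {q : A × I} {t : I} : κ.collar q ∈ κ.below t ↔ q.2 < t :=
  κ.collar_mem_image_iff

/-- `below t` lies in the range of the collar. [folklore] -/
theorem below_subset_range (t : I) : κ.below t ⊆ range κ.collar := image_subset_range _ _

/-- `below t` is open. [folklore] -/
theorem isOpen_below (t : I) : IsOpen (κ.below t) :=
  κ.isOpen_image_of_isOpen (isOpen_lt continuous_snd continuous_const) fun q hq =>
    lt_of_lt_of_le (show q.2 < t from hq) (unitInterval.le_one t)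

/-- **The core at level `t`**: `W ∖ κ (A × [0, t))`, the space with the open collar of height `t`
removed (Hatcher 2002, Prop. 3.42). [folklore] -/
def core (t : I) : Set W := (κ.below t)ᶜ

/-- Membership in the core (definitional). [folklore] -/
theorem mem_core_iff {w : W} {t : I} : w ∈ κ.core t ↔ w ∉ κ.below t := Iff.rfl

/-- A collar point lies in the core at level `t` iff its level is `≥ t`. [folklore] -/
@[simp] theorem collar_mem_core_iff {q : A × I} {t : I} : κ.collar q ∈ κ.core t ↔ t ≤ q.2 := by
  rw [mem_core_iff, collar_mem_below_iff, not_lt]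

/-- Points off the collar lie in every core. [folklore] -/
theorem mem_core_of_not_mem_range {w : W} (hw : w ∉ range κ.collar) (t : I) : w ∈ κ.core t :=
  fun h => hw (κ.below_subset_range t h)

/-- The core is closed. [folklore] -/
theorem isClosed_core (t : I) : IsClosed (κ.core t) := (κ.isOpen_below t).isClosed_compl

/-- The core of a compact space is compact. [folklore] -/
theorem isCompact_core [CompactSpace W] (t : I) : IsCompact (κ.core t) := (κ.isClosed_core t).isCompact

/-- The core at level `0` is everything. [folklore] -/
@[simp] theorem core_zero : κ.core 0 = univ := by
  refine eq_univ_of_forall fun w hw => ?_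
  obtain ⟨q, hq, -⟩ := hw
  exact absurd (show ((q.2 : I) : ℝ) < 0 from hq) (not_lt.2 (unitInterval.nonneg q.2))

/-- Cores decrease with the level. [folklore] -/
theorem core_mono {s t : I} (h : s ≤ t) : κ.core t ⊆ κ.core s := by
  intro w hw hws
  obtain ⟨q, hq, rfl⟩ := hws
  exact hw ⟨q, lt_of_lt_of_le hq h, rfl⟩

/-- **The interior**: the complement of the bottom `κ (A × {0})` of the collar ("`W ∖ ∂W`").
[folklore] -/
def interior : Set W := (range fun a : A => κ.collar (a, 0))ᶜ

/-- Membership in the interior (definitional). [folklore] -/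
theorem mem_interior_iff {w : W} : w ∈ κ.interior ↔ ∀ a : A, κ.collar (a, 0) ≠ w := by
  simp [interior]

/-- A collar point lies in the interior iff its level is positive. [folklore] -/
@[simp] theorem collar_mem_interior_iff {q : A × I} : κ.collar q ∈ κ.interior ↔ 0 < q.2 := by
  rw [mem_interior_iff]
  constructor
  · intro h
    refine lt_of_le_of_ne bot_le fun h0 => h q.1 ?_
    rw [show (q.1, (0 : I)) = q from Prod.ext rfl h0]
  · rintro h a ha
    have := congrArg Prod.snd (κ.injective ha)
    exact h.ne this

/-- Points off the collar lie in the interior. [folklore] -/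
theorem mem_interior_of_not_mem_range {w : W} (hw : w ∉ range κ.collar) : w ∈ κ.interior :=
  κ.mem_interior_iff.2 fun a ha => hw ⟨(a, 0), ha⟩

/-- For `t > 0` the core at level `t` lies in the interior. [folklore] -/
theorem core_subset_interior {t : I} (ht : 0 < t) : κ.core t ⊆ κ.interior := by
  intro w hw
  by_cases hr : w ∈ range κ.collar
  · obtain ⟨q, rfl⟩ := hr
    rw [collar_mem_core_iff] at hw
    exact κ.collar_mem_interior_iff.2 (lt_of_lt_of_le ht hw)
  · exact κ.mem_interior_of_not_mem_range hr

/-- The interior is open (the bottom of the collar is the image of the closed set `A × {0}` under a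
closed embedding). [folklore] -/
theorem isOpen_interior : IsOpen κ.interior := by
  have h : (range fun a : A => κ.collar (a, 0)) = κ.collar '' {q | q.2 = 0} := by
    ext w
    constructor
    · rintro ⟨a, rfl⟩; exact ⟨(a, 0), rfl, rfl⟩
    · rintro ⟨q, hq, rfl⟩
      refine ⟨q.1, ?_⟩
      show κ.collar (q.1, 0) = κ.collar q
      rw [show ((q.1, (0 : I)) : A × I) = q from Prod.ext rfl hq.symm]
  rw [interior, h]
  exact (κ.isClosedEmbedding_collar.isClosedMap _ (isClosed_eq continuous_snd continuous_const)).isOpen_compl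

variable [Nonempty A]

/-- A total inverse of the collar (junk off its range). [folklore] -/
def inv (w : W) : A × I :=
  if h : w ∈ range κ.collar then κ.isClosedEmbedding_collar.isEmbedding.toHomeomorph.symm ⟨w, h⟩
  else (Classical.arbitrary A, 0)

/-- `inv ∘ collar = id`. [folklore] -/
@[simp] theorem inv_collar (q : A × I) : κ.inv (κ.collar q) = q := by
  rw [inv, dif_pos (mem_range_self q)]
  exact κ.isClosedEmbedding_collar.isEmbedding.toHomeomorph_symm_apply q

/-- `inv` is continuous on the range of the collar. [folklore] -/
theorem continuousOn_inv : ContinuousOn κ.inv (range κ.collar) := by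
  rw [continuousOn_iff_continuous_restrict]
  have h : (range κ.collar).restrict κ.inv = κ.isClosedEmbedding_collar.isEmbedding.toHomeomorph.symm := by
    funext ⟨w, hw⟩
    simp only [restrict_apply, inv, dif_pos hw]
  rw [h]
  exact Homeomorph.continuous _

/-! ### The push to a level -/

/-- **The push to level `t`**: `κ (a, s) ↦ κ (a, max s t)` on the collar, the identity off it
(Hatcher 2002, Prop. 3.42: the deformation retraction of `W` onto the complement of an open collar).
[cite: HatcherAT2002, Prop. 3.42] -/
def push (t : I) (w : W) : W :=
  if w ∈ range κ.collar then κ.collar ((κ.inv w).1, max (κ.inv w).2 t) else w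

/-- The push on the collar. [folklore] -/
@[simp] theorem push_collar (t : I) (q : A × I) : κ.push t (κ.collar q) = κ.collar (q.1, max q.2 t) := by
  rw [push, if_pos (mem_range_self q), inv_collar]

/-- The push off the collar is the identity. [folklore] -/
theorem push_of_not_mem_range (t : I) {w : W} (hw : w ∉ range κ.collar) : κ.push t w = w := if_neg hw

/-- The push to level `0` is the identity. [folklore] -/
@[simp] theorem push_zero (w : W) : κ.push 0 w = w := by
  by_cases hw : w ∈ range κ.collar
  · obtain ⟨q, rfl⟩ := hw
    rw [push_collar]
    simp
  · exact κ.push_of_not_mem_range 0 hw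

/-- The push to level `t` is the identity on the core at level `t`. [folklore] -/
theorem push_of_mem_core {t : I} {w : W} (hw : w ∈ κ.core t) : κ.push t w = w := by
  by_cases hr : w ∈ range κ.collar
  · obtain ⟨q, rfl⟩ := hr
    rw [collar_mem_core_iff] at hw
    rw [push_collar, max_eq_left hw]
  · exact κ.push_of_not_mem_range t hr

/-- The push to level `t` takes values in the core at level `t`. [folklore] -/
theorem push_mem_core (t : I) (w : W) : κ.push t w ∈ κ.core t := by
  by_cases hr : w ∈ range κ.collar
  · obtain ⟨q, rfl⟩ := hr
    rw [push_collar, collar_mem_core_iff]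
    exact le_max_right _ _
  · rw [κ.push_of_not_mem_range t hr]
    exact κ.mem_core_of_not_mem_range hr t

/-- The pushes preserve every core. [folklore] -/
theorem push_mem_core_of_mem {s t : I} {w : W} (hw : w ∈ κ.core s) : κ.push t w ∈ κ.core s := by
  by_cases hr : w ∈ range κ.collar
  · obtain ⟨q, rfl⟩ := hr
    rw [collar_mem_core_iff] at hw
    rw [push_collar, collar_mem_core_iff]
    exact hw.trans (le_max_left _ _)
  · rw [κ.push_of_not_mem_range t hr]
    exact κ.mem_core_of_not_mem_range hr s

/-- The pushes preserve the interior. [folklore] -/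
theorem push_mem_interior {w : W} (hw : w ∈ κ.interior) (t : I) : κ.push t w ∈ κ.interior := by
  by_cases hr : w ∈ range κ.collar
  · obtain ⟨q, rfl⟩ := hr
    rw [collar_mem_interior_iff] at hw
    rw [push_collar, collar_mem_interior_iff]
    exact lt_of_lt_of_le hw (le_max_left _ _)
  · rwa [κ.push_of_not_mem_range t hr]

/-- **The pushes to levels `t ≤ s` do not hit a point `c` above level `s`** (`c ∉ κ (A × [0, s])`)
except from `c` itself. [folklore] -/
theorem push_ne {c : W} {s : I} (hc : c ∉ κ.collar '' {q | q.2 ≤ s}) {t : I} (hts : t ≤ s)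
    {w : W} (hw : w ≠ c) : κ.push t w ≠ c := by
  by_cases hr : w ∈ range κ.collar
  · obtain ⟨q, rfl⟩ := hr
    rw [push_collar]
    intro h
    rcases le_total q.2 t with hq | hq
    · exact hc ⟨(q.1, max q.2 t), (max_eq_right hq).trans_le hts, h⟩
    · rw [max_eq_left hq] at h
      exact hw h
  · rwa [κ.push_of_not_mem_range t hr]

omit [Nonempty A] in
/-- A point not in `κ (A × [0, s])` lies in the core at level `s`. [folklore] -/
theorem mem_core_of_not_mem_image {c : W} {s : I} (hc : c ∉ κ.collar '' {q | q.2 ≤ s}) :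
    c ∈ κ.core s := fun ⟨q, hq, h⟩ => hc ⟨q, (le_of_lt hq : q.2 ≤ s), h⟩

/-- **The push is jointly continuous in the level and the point**: pasting along the closed cover
of `I × W` by (the preimages of) `range κ` and `W ∖ κ (A × [0, 1))`, which meet in `κ (A × {1})`
where `κ (a, max 1 t) = κ (a, 1)`. [folklore] -/
theorem continuous_push : Continuous fun p : I × W => κ.push p.1 p.2 := by
  have hS : IsClosed {p : I × W | p.2 ∈ range κ.collar} :=
    κ.isClosedEmbedding_collar.isClosed_range.preimage continuous_snd
  have hS' : IsClosed {p : I × W | p.2 ∉ κ.collar '' {q | q.2 < 1}} := by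
    have : IsClosed ((κ.collar '' {q : A × I | q.2 < 1})ᶜ) := κ.isOpen_image.isClosed_compl
    exact this.preimage continuous_snd
  apply continuous_if
  · rintro ⟨t, w⟩ hfr
    have hw : w ∈ range κ.collar := by
      have := (frontier_subset_closure (s := {p : I × W | p.2 ∈ range κ.collar})) hfr
      rwa [hS.closure_eq] at this
    have hw' : w ∉ κ.collar '' {q | q.2 < 1} := by
      have hsub : {p : I × W | p.2 ∈ range κ.collar}ᶜ ⊆ {p : I × W | p.2 ∉ κ.collar '' {q | q.2 < 1}} :=
        fun p hp hp' => hp (image_subset_range _ _ hp')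
      have hfr' := hfr
      rw [frontier_eq_closure_inter_closure] at hfr'
      have := (closure_mono hsub) hfr'.2
      rwa [hS'.closure_eq] at this
    obtain ⟨q, rfl⟩ := hw
    have hq : q.2 = 1 := by
      by_contra h
      exact hw' ⟨q, lt_of_le_of_ne le_top h, rfl⟩
    show κ.collar ((κ.inv (κ.collar q)).1, max (κ.inv (κ.collar q)).2 t) = κ.collar q
    rw [inv_collar, hq, max_eq_left unitInterval.le_one', ← hq]
  · rw [hS.closure_eq]
    have hinv : ContinuousOn (fun p : I × W => κ.inv p.2) {p : I × W | p.2 ∈ range κ.collar} :=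
      κ.continuousOn_inv.comp continuous_snd.continuousOn fun p hp => hp
    have hF : Continuous fun r : (A × I) × I => κ.collar (r.1.1, max r.1.2 r.2) :=
      κ.continuous.comp ((continuous_fst.comp continuous_fst).prodMk
        ((continuous_snd.comp continuous_fst).max continuous_snd))
    exact hF.comp_continuousOn (hinv.prodMk continuous_fst.continuousOn)
  · exact continuous_snd.continuousOn

/-- The push at a fixed level is continuous. [folklore] -/
theorem continuous_push_left (t : I) : Continuous (κ.push t) :=
  κ.continuous_push.comp (Continuous.prodMk_right t)

/-! ### Inclusions that are homotopy equivalences -/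

/-- The level `min t (1 - s)` of the homotopies: `t` at `s = 0`, `0` at `s = 1`, always `≤ t`.
[folklore] -/
def lev (t s : I) : I := min t (unitInterval.symm s)

omit [Nonempty A] in
/-- The level is continuous in `s`. [folklore] -/
theorem continuous_lev (t : I) : Continuous (lev t) :=
  continuous_const.min unitInterval.continuous_symm

omit [Nonempty A] in
/-- The level is `≤ t`. [folklore] -/
theorem lev_le (t s : I) : lev t s ≤ t := min_le_left _ _

omit [Nonempty A] in
/-- At `s = 0` the level is `t`. [folklore] -/
@[simp] theorem lev_zero (t : I) : lev t 0 = t := by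
  rw [lev, unitInterval.symm_zero, min_eq_left unitInterval.le_one']

omit [Nonempty A] in
/-- At `s = 1` the level is `0`. [folklore] -/
@[simp] theorem lev_one (t : I) : lev t 1 = 0 := by
  rw [lev, unitInterval.symm_one, min_eq_right (show (0 : I) ≤ t from t.2.1)]

/-- **An inclusion `P ⊆ Q` of subsets stable under the pushes to levels `≤ t`, with `push t (Q) ⊆ P`,
is a homotopy equivalence**: the inverse is `push t`, and `s ↦ push (min t (1 - s))` deforms
`push t` to the identity inside `Q` and inside `P` (Hatcher 2002, Ch. 0, deformation retractions;
Prop. 3.42). [cite: HatcherAT2002, Prop. 3.42] -/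
def inclusionHomotopyEquiv (t : I) (P Q : Set W) (hPQ : P ⊆ Q)
    (hP : ∀ s, s ≤ t → MapsTo (κ.push s) P P) (hQ : ∀ s, s ≤ t → MapsTo (κ.push s) Q Q)
    (ht : MapsTo (κ.push t) Q P) : (↥P) ≃ₕ (↥Q) where
  toFun := ⟨Set.inclusion hPQ, continuous_inclusion hPQ⟩
  invFun := ⟨ht.restrict _ _ _, (κ.continuous_push_left t).restrict ht⟩
  left_inv :=
    ⟨{ toFun := fun p => ⟨κ.push (lev t p.1) p.2, hP _ (lev_le t p.1) p.2.2⟩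
       continuous_toFun := (κ.continuous_push.comp (((continuous_lev t).comp continuous_fst).prodMk
         (continuous_subtype_val.comp continuous_snd))).subtype_mk _
       map_zero_left := fun p => Subtype.ext (by simp)
       map_one_left := fun p => Subtype.ext (by simp) }⟩
  right_inv :=
    ⟨{ toFun := fun p => ⟨κ.push (lev t p.1) p.2, hQ _ (lev_le t p.1) p.2.2⟩
       continuous_toFun := (κ.continuous_push.comp (((continuous_lev t).comp continuous_fst).prodMk
         (continuous_subtype_val.comp continuous_snd))).subtype_mk _
       map_zero_left := fun p => Subtype.ext (by simp)
       map_one_left := fun p => Subtype.ext (by simp) }⟩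

/-- The forward map of `inclusionHomotopyEquiv` is the inclusion. [folklore] -/
@[simp] theorem inclusionHomotopyEquiv_apply (t : I) (P Q : Set W) (hPQ : P ⊆ Q)
    (hP : ∀ s, s ≤ t → MapsTo (κ.push s) P P) (hQ : ∀ s, s ≤ t → MapsTo (κ.push s) Q Q)
    (ht : MapsTo (κ.push t) Q P) (p : P) :
    (κ.inclusionHomotopyEquiv t P Q hPQ hP hQ ht p : W) = p := rfl

/-- **The interior is a deformation retract of `W`**: the inclusion `κ.interior ↪ W` (through
`Set.univ`) is a homotopy equivalence (push everything up to a positive level; Hatcher 2002,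
Prop. 3.42). [cite: HatcherAT2002, Prop. 3.42] -/
def interiorHomotopyEquivUniv {t : I} (ht : 0 < t) : (↥κ.interior) ≃ₕ (↥(univ : Set W)) :=
  κ.inclusionHomotopyEquiv t κ.interior univ (subset_univ _)
    (fun _ _ _ hw => κ.push_mem_interior hw _) (fun _ _ => mapsTo_univ _ _)
    fun w _ => κ.core_subset_interior ht (κ.push_mem_core t w)

/-- **The interior is a deformation retract of `W`**, as a homotopy equivalence `κ.interior ≃ₕ W`
whose forward map is the inclusion. [cite: HatcherAT2002, Prop. 3.42] -/
def interiorHomotopyEquiv {t : I} (ht : 0 < t) : (↥κ.interior) ≃ₕ W :=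
  (κ.interiorHomotopyEquivUniv ht).trans (Homeomorph.Set.univ W).toHomotopyEquiv

/-- The forward map of `interiorHomotopyEquiv` is the inclusion. [folklore] -/
@[simp] theorem interiorHomotopyEquiv_apply {t : I} (ht : 0 < t) (p : κ.interior) :
    κ.interiorHomotopyEquiv ht p = (p : W) := rfl

/-- **Puncturing at a point above the collar**: for `c ∉ κ (A × [0, t])`, `t > 0`, the inclusion
`κ.interior ∖ {c} ↪ W ∖ {c}` is a homotopy equivalence (the pushes to levels `≤ t` fix `c` and move
no other point to `c`). [cite: HatcherAT2002, Prop. 3.42] -/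
def interiorComplHomotopyEquiv {t : I} (ht : 0 < t) {c : W} (hc : c ∉ κ.collar '' {q | q.2 ≤ t}) :
    (↥(κ.interior ∩ {c}ᶜ)) ≃ₕ (↥({c}ᶜ : Set W)) :=
  κ.inclusionHomotopyEquiv t (κ.interior ∩ {c}ᶜ) {c}ᶜ inter_subset_right
    (fun s hs _ hw => ⟨κ.push_mem_interior hw.1 s, κ.push_ne hc hs hw.2⟩)
    (fun _ hs _ hw => κ.push_ne hc hs hw)
    fun w hw => ⟨κ.core_subset_interior ht (κ.push_mem_core t w), κ.push_ne hc le_rfl hw⟩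

/-- The forward map of `interiorComplHomotopyEquiv` is the inclusion. [folklore] -/
@[simp] theorem interiorComplHomotopyEquiv_apply {t : I} (ht : 0 < t) {c : W}
    (hc : c ∉ κ.collar '' {q | q.2 ≤ t}) (p : ↥(κ.interior ∩ {c}ᶜ)) :
    (κ.interiorComplHomotopyEquiv ht hc p : W) = p := rfl

/-! ### The open strip between the boundary and a level -/

omit [Nonempty A] in
/-- A convex combination of two levels of `[0, 1]` is a level. [folklore] -/
theorem convex_mem (s : I) (a b : I) : (1 - (s : ℝ)) * a + s * b ∈ I := by
  have hs := s.2; have ha := a.2; have hb := b.2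
  simp only [mem_Icc] at hs ha hb ⊢
  constructor <;> nlinarith

omit [Nonempty A] in
/-- **The open strip `κ (A × (0, t))`** between the boundary and level `t`, inside the interior:
it is the part of the interior below level `t`. [folklore] -/
def strip (t : I) : Set W := κ.collar '' {q | 0 < q.2 ∧ q.2 < t}

omit [Nonempty A] in
/-- The strip is the intersection of the interior with the open collar below level `t`. [folklore] -/
theorem strip_eq (t : I) : κ.strip t = κ.interior ∩ κ.below t := by
  ext w
  constructor
  · rintro ⟨q, hq, rfl⟩
    exact ⟨κ.collar_mem_interior_iff.2 hq.1, κ.collar_mem_below_iff.2 hq.2⟩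
  · rintro ⟨hi, q, hq, rfl⟩
    exact ⟨q, ⟨κ.collar_mem_interior_iff.1 hi, hq⟩, rfl⟩

omit [Nonempty A] in
/-- The strip is the complement of the core at level `t` inside the interior. [folklore] -/
theorem interior_diff_core (t : I) : κ.interior \ κ.core t = κ.strip t := by
  rw [strip_eq, core, sdiff_compl]

omit [Nonempty A] in
/-- The strip lies in the range of the collar. [folklore] -/
theorem strip_subset_range (t : I) : κ.strip t ⊆ range κ.collar := image_subset_range _ _

/-- `collar ∘ inv = id` on the range of the collar. [folklore] -/
theorem collar_inv {w : W} (hw : w ∈ range κ.collar) : κ.collar (κ.inv w) = w := by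
  obtain ⟨q, rfl⟩ := hw
  rw [inv_collar]

/-- The collar coordinates of a point of the strip: its level lies in `(0, t)`. [folklore] -/
theorem inv_snd_mem_of_mem_strip {t : I} {w : W} (hw : w ∈ κ.strip t) :
    0 < (κ.inv w).2 ∧ (κ.inv w).2 < t := by
  obtain ⟨q, hq, rfl⟩ := hw
  rwa [inv_collar]

/-- The collar coordinates depend continuously on a point of the strip. [folklore] -/
theorem continuous_inv_strip (t : I) : Continuous fun w : ↥(κ.strip t) => κ.inv w :=
  κ.continuousOn_inv.comp_continuous continuous_subtype_val fun w => κ.strip_subset_range t w.2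

omit [Nonempty A] in
/-- The level `(1 - r) u + r s` interpolating two levels of `(0, t)` lies in `(0, t)`. [folklore] -/
theorem lerp_mem {r : I} {u s t : I} (hu : 0 < u) (hut : u < t) (hs : 0 < s) (hst : s < t) :
    (0 : I) < ⟨(1 - (r : ℝ)) * u + r * s, convex_mem r u s⟩ ∧
      (⟨(1 - (r : ℝ)) * u + r * s, convex_mem r u s⟩ : I) < t := by
  have hr := r.2
  simp only [mem_Icc] at hr
  have hu' : (0 : ℝ) < u := hu
  have hut' : (u : ℝ) < t := hut
  have hs' : (0 : ℝ) < s := hs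
  have hst' : (s : ℝ) < t := hst
  constructor
  · show (0 : ℝ) < (1 - (r : ℝ)) * u + r * s
    have hm : 0 < min (u : ℝ) s := lt_min hu' hs'
    nlinarith [min_le_left (u : ℝ) s, min_le_right (u : ℝ) s, mul_nonneg (sub_nonneg.2 hr.2)
      (sub_nonneg.2 (min_le_left (u : ℝ) s)), mul_nonneg hr.1 (sub_nonneg.2 (min_le_right (u : ℝ) s))]
  · show (1 - (r : ℝ)) * u + r * s < t
    have hm : 0 < min ((t : ℝ) - u) (t - s) := lt_min (by linarith) (by linarith)
    nlinarith [min_le_left ((t : ℝ) - u) (t - s), min_le_right ((t : ℝ) - u) (t - s),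
      mul_nonneg (sub_nonneg.2 hr.2) (sub_nonneg.2 (min_le_left ((t : ℝ) - u) (t - s))),
      mul_nonneg hr.1 (sub_nonneg.2 (min_le_right ((t : ℝ) - u) (t - s)))]

/-- **The slice `a ↦ κ (a, u)` at a level `0 < u < t` is a homotopy equivalence `A ≃ₕ κ (A × (0, t))`**
onto the strip: the inverse is the `A`-coordinate `κ (a, s) ↦ a`, and
`κ (a, s) ↦ κ (a, (1 - r) u + r s)` deforms the composite to the identity inside the strip. [folklore] -/
def stripHomotopyEquiv {u t : I} (hu : 0 < u) (hut : u < t) : A ≃ₕ ↥(κ.strip t) where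
  toFun := ⟨fun a => ⟨κ.collar (a, u), (a, u), ⟨hu, hut⟩, rfl⟩,
    (κ.continuous.comp (Continuous.prodMk_left u)).subtype_mk _⟩
  invFun := ⟨fun w => (κ.inv w).1, continuous_fst.comp (κ.continuous_inv_strip t)⟩
  left_inv := by
    have h : (⟨fun w : ↥(κ.strip t) => (κ.inv w).1, continuous_fst.comp (κ.continuous_inv_strip t)⟩ :
        C(↥(κ.strip t), A)).comp ⟨fun a => ⟨κ.collar (a, u), (a, u), ⟨hu, hut⟩, rfl⟩,
          (κ.continuous.comp (Continuous.prodMk_left u)).subtype_mk _⟩ = ContinuousMap.id A := by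
      ext a
      simp
    rw [h]
  right_inv :=
    ⟨{ toFun := fun p => ⟨κ.collar ((κ.inv p.2).1,
          ⟨(1 - (p.1 : ℝ)) * u + p.1 * (κ.inv p.2).2, convex_mem p.1 u (κ.inv p.2).2⟩),
          ((κ.inv p.2).1, _), lerp_mem hu hut (κ.inv_snd_mem_of_mem_strip p.2.2).1
            (κ.inv_snd_mem_of_mem_strip p.2.2).2, rfl⟩
       continuous_toFun := by
         refine (κ.continuous.comp ?_).subtype_mk _
         have hinv : Continuous fun p : I × ↥(κ.strip t) => κ.inv p.2 :=
           (κ.continuous_inv_strip t).comp continuous_snd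
         refine (continuous_fst.comp hinv).prodMk (Continuous.subtype_mk ?_ _)
         have hr : Continuous fun p : I × ↥(κ.strip t) => (p.1 : ℝ) := continuous_subtype_val.comp continuous_fst
         exact ((continuous_const.sub hr).mul continuous_const).add
           (hr.mul (continuous_subtype_val.comp (continuous_snd.comp hinv)))
       map_zero_left := fun w => Subtype.ext (by
         show κ.collar ((κ.inv w).1, _) = κ.collar ((κ.inv w).1, u)
         congr 2
         apply Subtype.ext
         simp)
       map_one_left := fun w => Subtype.ext (by
         show κ.collar ((κ.inv w).1, _) = (w : W)
         conv_rhs => rw [← κ.collar_inv (κ.strip_subset_range t w.2), ← Prod.mk.eta (p := κ.inv w)]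
         congr 2
         apply Subtype.ext
         simp) }⟩

/-- The forward map of `stripHomotopyEquiv` is the slice `a ↦ κ (a, u)`. [folklore] -/
@[simp] theorem stripHomotopyEquiv_apply {u t : I} (hu : 0 < u) (hut : u < t) (a : A) :
    (κ.stripHomotopyEquiv hu hut a : W) = κ.collar (a, u) := rfl

/-! ### Slices are homotopic to the boundary inclusion -/

omit [Nonempty A] in
/-- The product of two levels is a level. [folklore] -/
theorem mul_mem' (r u : I) : (r : ℝ) * u ∈ I := unitInterval.mul_mem r.2 u.2

omit [Nonempty A] in
/-- **The slice `a ↦ κ (a, u)` at a level `u ≤ t` is homotopic, inside `W ∖ {c}` for any point `c`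
above level `t`, to the boundary inclusion `a ↦ κ (a, 0)`** (slide down the collar:
`(r, a) ↦ κ (a, r u)`). [folklore] -/
theorem sliceHomotopic {t u : I} (hut : u ≤ t) {c : W} (hc : c ∉ κ.collar '' {q | q.2 ≤ t}) :
    ContinuousMap.Homotopic
      (⟨fun a => ⟨κ.collar (a, 0), fun h => hc ⟨(a, 0), (t.2.1 : (0 : I) ≤ t), h⟩⟩,
        (κ.continuous.comp (Continuous.prodMk_left 0)).subtype_mk _⟩ : C(A, ↥(({c}ᶜ : Set W))))
      ⟨fun a => ⟨κ.collar (a, u), fun h => hc ⟨(a, u), hut, h⟩⟩,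
        (κ.continuous.comp (Continuous.prodMk_left u)).subtype_mk _⟩ :=
  ⟨{ toFun := fun p => ⟨κ.collar (p.2, ⟨(p.1 : ℝ) * u, mul_mem' p.1 u⟩), fun h =>
        hc ⟨(p.2, ⟨(p.1 : ℝ) * u, mul_mem' p.1 u⟩), le_trans (show ((⟨(p.1 : ℝ) * u, mul_mem' p.1 u⟩ : I) : ℝ) ≤ u from
          mul_le_of_le_one_left u.2.1 p.1.2.2) (show (u : ℝ) ≤ t from hut), h⟩⟩
     continuous_toFun := (κ.continuous.comp (continuous_snd.prodMk (Continuous.subtype_mk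
       ((continuous_subtype_val.comp continuous_fst).mul continuous_const) _))).subtype_mk _
     map_zero_left := fun a => Subtype.ext (by
       show κ.collar (a, _) = κ.collar (a, 0)
       congr 2; apply Subtype.ext; simp)
     map_one_left := fun a => Subtype.ext (by
       show κ.collar (a, _) = κ.collar (a, u)
       congr 2; apply Subtype.ext; simp) }⟩

end BoundaryCollar

end Literature.AlgebraicTopology.Homotopy

end
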